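import Summits.NavierStokesRegularity.NavierStokesRegularity.Theorems.AdaptedFrequencyFrequencyRigidityFiniteBridges
import Literature.Analysis.FluidPDE.LocalTypeISlabProfile
import HarnessLib

/-!
# Crux `FrequencyRigidity` (stmt-NavierStokesRegularity-2955), line `scaled-energy-split`:
# the finite piece from "no local Type-I singularity" (Albritton–Barker's first bullet)

Helper file (`--supports stmt-NavierStokesRegularity-2955`; theorems only, sorry-free).  Anchors Stub 2
`stub_finiteScaledEnergyLiouville` in the literature's printed vocabulary: a finite-scaled-energy witness,
viscosity-normalised (`classical_viscosity`, `typeIBound_viscosity_lt_top`, `isBackwardSingularPoint_viscosity`,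
landed) and read as a suitable weak solution on the slab (`stub_classicalSuitableSlab`, landed), is a slab profile
with `𝐈 < ⊤` that is backward-singular at the origin, hence has a LOCAL TYPE-I SINGULAR POINT at `(0,0)` in the
sense of Albritton–Barker 2019 §1 / Def. 2.1 (tree `localTypeISingularityExists_of_slabProfile`; cf. the landed
`stub_localTypeISingularity_of_finiteWitness`, worker D of lead c6).  So Stub 2 follows from the negation of the
registered OPEN statement `LocalTypeISingularityExists` (first bullet of A–B Thm 1.1, conjecturally false under
KNSS (L)): `stub_finiteOfNoLocalTypeISingularity`.  Upper bounds of Stub 2 now in the tree: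
`¬LocalTypeISingularityExists ⇒ Stub 2`, `NoTypeIRateProfile (stmt-1588) ⇒ Stub 2`,
`TypeIAncientLiouville (stmt-4050) ⇒ crux ⇒ Stub 2`, `(L) ⇒ (L′)`.

## References

* D. Albritton, T. Barker, J. Math. Fluid Mech. 21 (2019), Thm 1.1, §1, Def. 2.1. [AlbrittonBarker2019]
-/

noncomputable section

set_option linter.dupNamespace false

namespace Summit.NavierStokesRegularity.NavierStokesRegularity.Theorems.FrequencyRigidity.ScaledEnergySplit

open Literature.Analysis.FluidPDE Set

/-- **Every finite-scaled-energy witness yields a local Type-I singularity** (A–B's first bullet). [cite: AlbrittonBarker2019, Thm 1.1] -/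
theorem localTypeISingularityExists_of_finiteWitness {ν C Λ₀ : ℝ}
    {v : ℝ → EuclideanSpace ℝ (Fin 3) → EuclideanSpace ℝ (Fin 3)} {q : ℝ → EuclideanSpace ℝ (Fin 3) → ℝ}
    {K : ℝ → EuclideanSpace ℝ (Fin 3) → ℝ} (hν : 0 < ν) (hNS : IsClassicalNSSolutionOn (Iio 0) ν 0 v q)
    (hTI : Negative.TypeIBound C v) (hKc : Negative.KernelClauses ν v K) (hCmp : Negative.Comparable K)
    (hF : Negative.FreqClause v K Λ₀)
    (hI : typeIBound (Iio (0:ℝ) ×ˢ univ) v q (fun t x => fderiv ℝ (v t) x) < ⊤) :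
    LocalTypeISingularityExists := by
  have hsing := isBackwardSingularPoint_of_witness hν hNS hTI hKc hCmp hF
  have h1 := classical_viscosity hν hNS
  have h3 := typeIBound_viscosity_lt_top (q := q) hν hI
  have h4 := isBackwardSingularPoint_viscosity hν hsing
  obtain ⟨hsw, hG⟩ := stub_classicalSuitableSlab _ _ h1
  exact localTypeISingularityExists_of_slabProfile hsw hG h3 h4

/-- **Registered sub-goal `stub_finiteOfNoLocalTypeISingularity` (line `scaled-energy-split`): Stub 2 follows from
the negation of Albritton–Barker's first bullet `LocalTypeISingularityExists`.** [cite: AlbrittonBarker2019, Thm 1.1] -/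
theorem stub_finiteOfNoLocalTypeISingularity : ¬ Literature.Analysis.FluidPDE.LocalTypeISingularityExists → ¬ ∃ (ν C Λ₀ : ℝ) (v : ℝ → EuclideanSpace ℝ (Fin 3) → EuclideanSpace ℝ (Fin 3)) (q : ℝ → EuclideanSpace ℝ (Fin 3) → ℝ) (K : ℝ → EuclideanSpace ℝ (Fin 3) → ℝ), (0 < ν ∧ Literature.Analysis.FluidPDE.IsClassicalNSSolutionOn (Set.Iio 0) ν 0 v q ∧ (∀ t ∈ Set.Iio (0:ℝ), ∀ x, ‖v t x‖ ≤ C / Real.sqrt (-t)) ∧ ContDiffOn ℝ 2 (Function.uncurry K) (Set.Iio (0:ℝ) ×ˢ Set.univ) ∧ (∀ t ∈ Set.Iio (0:ℝ), ∀ x, 0 < K t x) ∧ (∀ t ∈ Set.Iio (0:ℝ), ∀ x, Literature.Analysis.FluidPDE.timeDerivWithin (Set.Iio (0:ℝ)) K t x + fderiv ℝ (K t) x (v t x) + ν * Laplacian.laplacian (K t) x = 0) ∧ (∀ t ∈ Set.Iio (0:ℝ), ∫ x, K t x = 1) ∧ (∀ φ : EuclideanSpace ℝ (Fin 3) → ℝ,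 Continuous φ → (∃ M : ℝ, ∀ x, |φ x| ≤ M) → Filter.Tendsto (fun t => ∫ x, φ x * K t x) (nhdsWithin (0:ℝ) (Set.Iio (0:ℝ))) (nhds (φ (0 : EuclideanSpace ℝ (Fin 3))))) ∧ (∃ c₁ c₂ C₁ C₂ : ℝ, 0 < c₁ ∧ 0 < c₂ ∧ 0 < C₁ ∧ 0 < C₂ ∧ ∀ t ∈ Set.Iio (0:ℝ), ∀ x, c₁ * ((0:ℝ) - t) ^ (-(3:ℝ) / 2) * Real.exp (-(‖x - (0 : EuclideanSpace ℝ (Fin 3))‖ ^ 2) / (c₂ * ((0:ℝ) - t))) ≤ K t x ∧ K t x ≤ C₁ * ((0:ℝ) - t) ^ (-(3:ℝ) / 2) * Real.exp (-(‖x - (0 : EuclideanSpace ℝ (Fin 3))‖ ^ 2) / (C₂ * ((0:ℝ) - t)))) ∧ (∀ H Λ : ℝ → ℝ, H = (fun t => ∫ x, ‖Literature.Analysis.FluidPDE.curl (v t) x‖ ^ 2 * K t x) → Λ = (fun t => (0 - t) * deriv H t / H t) → (∀ t ∈ Set.Iio (0:ℝ), 0 < H t) ∧ (∀ t ∈ Set.Iio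 (0:ℝ), Λ t = Λ₀))) ∧ Literature.Analysis.FluidPDE.typeIBound (Set.Iio (0:ℝ) ×ˢ Set.univ) v q (fun t x => fderiv ℝ (v t) x) < ⊤ := by
  intro hno
  rintro ⟨ν, C, Λ₀, v, q, K, hbody, hI⟩
  obtain ⟨hν, hNS, hTI, hKc, hCmp, hF⟩ := (body_iff_bundles ν C Λ₀ v q K).1 hbody
  exact hno (localTypeISingularityExists_of_finiteWitness hν hNS hTI hKc hCmp hF hI)

end Summit.NavierStokesRegularity.NavierStokesRegularity.Theorems.FrequencyRigidity.ScaledEnergySplit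

end
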